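import Mathlib.MeasureTheory.Integral.MeanInequalities
import Mathlib.MeasureTheory.Integral.Lebesgue.Countable
import Mathlib.Analysis.SpecificLimits.Basic
import Literature.Analysis.FluidPDE.LittlewoodPaleyBlockFn
import HarnessLib

/-!
# The bilinear Littlewood–Paley block estimate `∑_N N⁻¹ ‖P_N B(f, g)‖_∞ ≲ ‖∇f‖₂ ‖∇g‖₂` on `ℝ³`

Second support file for the Littlewood–Paley proof of Tao 2011, Prop. 9.1 (bounded total speed,
arXiv:1108.1165, §9; leaf `tao2011_duhamelNonlinearSpeed_unit` of `TaoBoundedTotalSpeed.lean`).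
The fixed-time heart of that proof is the estimate of (9.7),
"`∑_N ∫₀ᵀ N⁻¹ ‖P_N O(uu)(t')‖_{L^∞_x} dt' ≲ … ≲ ∑_N a_N² ≲ E₀`" (p. 28), which Tao obtains from the
Littlewood–Paley (paraproduct) trichotomy, Bernstein's inequality, Bessel and Schur's test. This
file **proves** its fixed-time form for a general continuous bilinear map `B` on Euclidean spaces
(main theorem `exists_tsum_eLpNorm_top_blockFn_bilinear_le`): for `C¹` fields `f, g ∈ L²(ℝ³)`
with `Df, Dg ∈ L²`,

  `∑_{n ∈ ℤ} 2^{-n} ‖Δ̇_n B(f, g)‖_{L^∞(ℝ³)} ≤ C ‖B‖ ‖Df‖_{L²} ‖Dg‖_{L²}`.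

**The argument (a variant of the printed one that needs no Fourier-support information on
products).** Expanding `f = ∑_m f_m`, `g = ∑_{m'} g_{m'}` in `L²` (`Δ̇_n : L¹ → L^∞` is bounded,
`eLpNorm_top_blockFn_bilinear_le_tsum`), it suffices to bound, for each pair of input frequencies
`(M, M') = (2^m, 2^{m'})`, the sum over the output frequency `N = 2^n` of
`N⁻¹‖Δ̇_n B(f_m, g_{m'})‖_∞`. With `a_m = M‖f_m‖₂`, `b_{m'} = M'‖g_{m'}‖₂` and Bernstein
(`‖f_m‖_∞ ≲ M^{3/2}‖f_m‖₂`): for `N ≤ max(M, M')`, Bernstein `L² → L^∞` on the output block with the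
`L^∞` norm on the block of *lower* input frequency gives `≲ ‖B‖ N^{1/2} min^{1/2} max⁻¹ a_m b_{m'}`;
for `N > max(M, M')`, the uniform `L^∞` bound of the output block gives
`≲ ‖B‖ N⁻¹ (MM')^{1/2} a_m b_{m'}` (`exists_bilinear_triple_bound`); both regimes sum over `N` to
`≲ ‖B‖ (min/max)^{1/2} a_m b_{m'} = ‖B‖ 2^{-|m-m'|/2} a_m b_{m'}` (`exists_bilinear_pair_bound`,
`tsum_regimeWeight_eq`). Schur's test for the kernel `2^{-|m-m'|/2}` on `ℓ²(ℤ)`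
(`tsum_tsum_two_rpow_neg_abs_mul_le`) and the gradient square function
`∑_m a_m² ≲ ‖Df‖₂²` (`exists_tsum_sq_blockFn_le_fderiv`, `LittlewoodPaleyBlockFn.lean`) conclude.
(Tao's trichotomy discards the pairs that cannot contribute to the output block; here every pair
is kept and estimated, which costs nothing since the three Bernstein bounds already decay
geometrically away from the diagonal.)

Also: dyadic arithmetic in `ℝ≥0∞` (half-line geometric sums over `ℤ`, `tsum_ite_le_two_rpow_half`,
`tsum_ite_lt_two_rpow_neg`), Cauchy–Schwarz over `ℤ` (`tsum_mul_le_sqrt_tsum_sq_mul_sqrt_tsum_sq`),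
and Hölder bounds for continuous bilinear maps of `L^p` fields (`memLp_one_clm_apply_of_two_two`
etc.). No definitions are introduced.

## Mathlib / tree search

`lean search 'paraproduct|trichotomy|Bony'`: nothing in Mathlib or the tree; `lean search 'blockFn.*mul|product.*lpBlock'`:
no block estimate for products. Reused: `LittlewoodPaleyBlockFn` (this programme),
`two_rpow_mul_two_rpow` (`LittlewoodPaleyBernsteinProofs`), `blockFn_sum`, `blockFn_sub`,
`memLp_blockFn`, `memLp_top_blockFn` (`LittlewoodPaleyKernel`). Mathlib:
`ENNReal.lintegral_mul_le_Lp_mul_Lq` with `lintegral_count` (Hölder on `ℤ`),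
`ENNReal.tsum_geometric`, `Function.Injective.tsum_eq`, `ENNReal.tsum_comm`,
`eLpNorm_le_eLpNorm_mul_eLpNorm_of_nnnorm`, `MemLp.of_bilin`, `ENNReal.Tendsto.mul`,
`ge_of_tendsto'`.

## References

* T. Tao, *Localisation and compactness properties of the Navier–Stokes global regularity
  problem*, Anal. PDE 6 (2013) 25–107 = arXiv:1108.1165 (`Tao2011`), §9, proof of Prop. 9.1
  (arXiv pp. 27–28: (9.7), the two Bernstein estimates, "`a_N := ‖∇u_N‖`", Bessel, Schur's test).
* H. Bahouri, J.-Y. Chemin, R. Danchin, *Fourier Analysis and Nonlinear Partial Differential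
  Equations*, Springer 2011 (`BahouriCheminDanchin2011`): Lemma 2.1 (Bernstein), Prop. 2.12.
-/

noncomputable section

open MeasureTheory SchwartzMap Filter Topology
open scoped ENNReal NNReal FourierTransform

namespace Literature.Analysis.FluidPDE

open FunctionSpaces

/-! ## Dyadic arithmetic in `ℝ≥0∞` -/

section Dyadic

/-- `2^a ≠ 0` in `ℝ≥0∞`. [folklore] -/
theorem two_rpow_ne_zero (a : ℝ) : (2 : ℝ≥0∞) ^ a ≠ 0 :=
  (ENNReal.rpow_pos (by norm_num) ENNReal.ofNat_ne_top).ne'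

/-- `2^a ≠ ∞` in `ℝ≥0∞`. [folklore] -/
theorem two_rpow_ne_top (a : ℝ) : (2 : ℝ≥0∞) ^ a ≠ ⊤ := fun h => by
  rcases ENNReal.rpow_eq_top_iff.1 h with ⟨h0, -⟩ | ⟨ht, -⟩
  · norm_num at h0
  · norm_num at ht

/-- Monotonicity of `a ↦ 2^a` in `ℝ≥0∞`. [folklore] -/
theorem two_rpow_le_two_rpow {a b : ℝ} (h : a ≤ b) : (2 : ℝ≥0∞) ^ a ≤ (2 : ℝ≥0∞) ^ b :=
  ENNReal.rpow_le_rpow_of_exponent_le (by norm_num) h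

/-- `2^{-(n s)} = (2^{-s})^n` for natural `n`. [folklore] -/
theorem two_rpow_neg_natCast_mul (s : ℝ) (n : ℕ) :
    (2 : ℝ≥0∞) ^ (-((n : ℝ) * s)) = ((2 : ℝ≥0∞) ^ (-s)) ^ n := by
  rw [← ENNReal.rpow_natCast, ← ENNReal.rpow_mul]
  congr 1
  ring

/-- `2^{-s} < 1` for `s > 0`. [folklore] -/
theorem two_rpow_neg_lt_one {s : ℝ} (hs : 0 < s) : (2 : ℝ≥0∞) ^ (-s) < 1 :=
  ENNReal.rpow_lt_one_of_one_lt_of_neg (by norm_num) (by linarith)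

/-- **Geometric sums in `ℝ≥0∞`**: `∑_{n ∈ ℕ} 2^{a - n s} = 2^a (1 - 2^{-s})⁻¹` for `s > 0`. [folklore] -/
theorem tsum_two_rpow_sub_natCast_mul (a : ℝ) (s : ℝ) :
    ∑' n : ℕ, (2 : ℝ≥0∞) ^ (a - (n : ℝ) * s) = (2 : ℝ≥0∞) ^ a * (1 - (2 : ℝ≥0∞) ^ (-s))⁻¹ := by
  have h : ∀ n : ℕ, (2 : ℝ≥0∞) ^ (a - (n : ℝ) * s) = (2 : ℝ≥0∞) ^ a * ((2 : ℝ≥0∞) ^ (-s)) ^ n := by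
    intro n
    rw [sub_eq_add_neg, ← two_rpow_mul_two_rpow, two_rpow_neg_natCast_mul]
  simp_rw [h]
  rw [ENNReal.tsum_mul_left, ENNReal.tsum_geometric]

/-- The geometric factor `(1 - 2^{-s})⁻¹` is finite for `s > 0`. [folklore] -/
theorem inv_one_sub_two_rpow_neg_ne_top {s : ℝ} (hs : 0 < s) :
    (1 - (2 : ℝ≥0∞) ^ (-s))⁻¹ ≠ ⊤ :=
  ENNReal.inv_ne_top.2 (tsub_pos_iff_lt.2 (two_rpow_neg_lt_one hs)).ne'

/-- **Sums over a lower half-line of `ℤ`** reduce to sums over `ℕ`: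
`∑_{n ≤ L} F(n) = ∑_{k ∈ ℕ} F(L - k)`. [folklore] -/
theorem tsum_ite_le_eq_tsum_nat (L : ℤ) (F : ℤ → ℝ≥0∞) :
    ∑' n : ℤ, (if n ≤ L then F n else 0) = ∑' k : ℕ, F (L - k) := by
  have hinj : Function.Injective fun k : ℕ => L - (k : ℤ) := fun a b h => by
    simpa using h
  have hsupp : Function.support (fun n : ℤ => if n ≤ L then F n else 0) ⊆
      Set.range fun k : ℕ => L - (k : ℤ) := by
    intro n hn
    have hnL : n ≤ L := by
      by_contra h
      exact hn (if_neg h)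
    refine ⟨(L - n).toNat, ?_⟩
    dsimp only
    rw [Int.toNat_of_nonneg (sub_nonneg.2 hnL)]
    ring
  rw [← hinj.tsum_eq hsupp]
  refine tsum_congr fun k => ?_
  rw [if_pos (by linarith [Int.natCast_nonneg k])]

/-- **Sums over an upper half-line of `ℤ`** reduce to sums over `ℕ`:
`∑_{n > L} F(n) = ∑_{k ∈ ℕ} F(L + 1 + k)`. [folklore] -/
theorem tsum_ite_lt_eq_tsum_nat (L : ℤ) (F : ℤ → ℝ≥0∞) :
    ∑' n : ℤ, (if L < n then F n else 0) = ∑' k : ℕ, F (L + 1 + k) := by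
  have hinj : Function.Injective fun k : ℕ => L + 1 + (k : ℤ) := fun a b h => by
    simpa using h
  have hsupp : Function.support (fun n : ℤ => if L < n then F n else 0) ⊆
      Set.range fun k : ℕ => L + 1 + (k : ℤ) := by
    intro n hn
    have hnL : L < n := by
      by_contra h
      exact hn (if_neg h)
    refine ⟨(n - L - 1).toNat, ?_⟩
    dsimp only
    rw [Int.toNat_of_nonneg (by linarith)]
    ring
  rw [← hinj.tsum_eq hsupp]
  refine tsum_congr fun k => ?_
  rw [if_pos (by linarith [Int.natCast_nonneg k])]

/-- `∑_{n ≤ L} 2^{n/2} = 2^{L/2} (1 - 2^{-1/2})⁻¹`. [folklore] -/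
theorem tsum_ite_le_two_rpow_half (L : ℤ) :
    ∑' n : ℤ, (if n ≤ L then (2 : ℝ≥0∞) ^ ((n : ℝ) / 2) else 0) =
      (2 : ℝ≥0∞) ^ ((L : ℝ) / 2) * (1 - (2 : ℝ≥0∞) ^ (-(1 / 2 : ℝ)))⁻¹ := by
  rw [tsum_ite_le_eq_tsum_nat L (fun n => (2 : ℝ≥0∞) ^ ((n : ℝ) / 2)),
    ← tsum_two_rpow_sub_natCast_mul ((L : ℝ) / 2) (1 / 2 : ℝ)]
  refine tsum_congr fun k => ?_
  push_cast
  ring_nf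

/-- `∑_{n > L} 2^{-n} = 2^{-L}`. [folklore] -/
theorem tsum_ite_lt_two_rpow_neg (L : ℤ) :
    ∑' n : ℤ, (if L < n then (2 : ℝ≥0∞) ^ (-(n : ℝ)) else 0) = (2 : ℝ≥0∞) ^ (-(L : ℝ)) := by
  rw [tsum_ite_lt_eq_tsum_nat L (fun n => (2 : ℝ≥0∞) ^ (-(n : ℝ)))]
  have h : ∀ k : ℕ, (2 : ℝ≥0∞) ^ (-(((L + 1 + (k : ℤ) : ℤ) : ℝ))) =
      (2 : ℝ≥0∞) ^ ((-(L : ℝ) - 1) - (k : ℝ) * 1) := fun k => by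
    push_cast
    ring_nf
  simp_rw [h]
  rw [tsum_two_rpow_sub_natCast_mul]
  have h2 : (1 - (2 : ℝ≥0∞) ^ (-(1 : ℝ)))⁻¹ = 2 := by
    rw [ENNReal.rpow_neg_one, ENNReal.one_sub_inv_two, inv_inv]
  rw [h2, sub_eq_add_neg, ← two_rpow_mul_two_rpow, ENNReal.rpow_neg_one, mul_assoc,
    ENNReal.inv_mul_cancel two_ne_zero ENNReal.ofNat_ne_top, mul_one]

/-- **Cauchy–Schwarz for sums over `ℤ` in `ℝ≥0∞`.** [folklore] -/
theorem tsum_mul_le_sqrt_tsum_sq_mul_sqrt_tsum_sq (a b : ℤ → ℝ≥0∞) :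
    ∑' n, a n * b n ≤ (∑' n, a n ^ 2) ^ (1 / 2 : ℝ) * (∑' n, b n ^ 2) ^ (1 / 2 : ℝ) := by
  have h := ENNReal.lintegral_mul_le_Lp_mul_Lq (Measure.count : Measure ℤ)
    Real.HolderConjugate.two_two (f := a) (g := b) (Measurable.of_discrete).aemeasurable
    (Measurable.of_discrete).aemeasurable
  simp only [lintegral_count, Pi.mul_apply] at h
  simpa only [ENNReal.rpow_two, ← ENNReal.rpow_natCast] using h

/-- **Schur's test for the kernel `2^{-|m - m'|/2}` on `ℓ²(ℤ)`**:
`∑_{m, m'} 2^{-|m-m'|/2} a_m b_{m'} ≤ S (∑ a²)^{1/2} (∑ b²)^{1/2}` with `S = ∑_k 2^{-|k|/2} < ∞`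
(Tao 2011, end of the proof of Prop. 9.1: "the claim then follows from Schur's test (or Young's
inequality)"). [cite: Tao2011, Prop. 9.1 (proof, last step)] -/
theorem tsum_tsum_two_rpow_neg_abs_mul_le (a b : ℤ → ℝ≥0∞) :
    ∑' m : ℤ, ∑' m' : ℤ, (2 : ℝ≥0∞) ^ (-(|(m : ℝ) - (m' : ℝ)| / 2)) * (a m * b m') ≤
      (∑' k : ℤ, (2 : ℝ≥0∞) ^ (-(|(k : ℝ)| / 2))) *
        ((∑' n, a n ^ 2) ^ (1 / 2 : ℝ) * (∑' n, b n ^ 2) ^ (1 / 2 : ℝ)) := by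
  -- reindex `m' = m + k`
  have hre : ∀ m : ℤ, ∑' m' : ℤ, (2 : ℝ≥0∞) ^ (-(|(m : ℝ) - (m' : ℝ)| / 2)) * (a m * b m') =
      ∑' k : ℤ, (2 : ℝ≥0∞) ^ (-(|(k : ℝ)| / 2)) * (a m * b (m + k)) := by
    intro m
    rw [← (Equiv.addLeft m).tsum_eq]
    refine tsum_congr fun k => ?_
    simp only [Equiv.coe_addLeft, Int.cast_add]
    congr 2
    rw [show (m : ℝ) - (m + k) = -k by ring, abs_neg]
  simp_rw [hre]
  rw [ENNReal.tsum_comm]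
  simp_rw [ENNReal.tsum_mul_left]
  rw [← ENNReal.tsum_mul_right]
  refine ENNReal.tsum_le_tsum fun k => ?_
  gcongr
  -- Cauchy–Schwarz and shift invariance
  have hshift : ∑' m, b (m + k) ^ 2 = ∑' n, b n ^ 2 :=
    (Equiv.addRight k).tsum_eq (fun n => b n ^ 2)
  calc ∑' m, a m * b (m + k) ≤ (∑' n, a n ^ 2) ^ (1 / 2 : ℝ) * (∑' m, b (m + k) ^ 2) ^ (1 / 2 : ℝ) :=
        tsum_mul_le_sqrt_tsum_sq_mul_sqrt_tsum_sq a fun m => b (m + k)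
    _ = (∑' n, a n ^ 2) ^ (1 / 2 : ℝ) * (∑' n, b n ^ 2) ^ (1 / 2 : ℝ) := by rw [hshift]

/-- The Schur constant `∑_k 2^{-|k|/2}` is finite. [folklore] -/
theorem tsum_two_rpow_neg_abs_half_ne_top :
    (∑' k : ℤ, (2 : ℝ≥0∞) ^ (-(|(k : ℝ)| / 2))) ≠ ⊤ := by
  have hpt : ∀ k : ℤ, (2 : ℝ≥0∞) ^ (-(|(k : ℝ)| / 2)) =
      (if k ≤ 0 then (2 : ℝ≥0∞) ^ ((k : ℝ) / 2) else 0) +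
        (if (0 : ℤ) < k then (2 : ℝ≥0∞) ^ (-(k : ℝ) / 2) else 0) := by
    intro k
    rcases le_or_gt k 0 with hk | hk
    · rw [if_pos hk, if_neg (not_lt.2 hk), add_zero,
        abs_of_nonpos (by exact_mod_cast hk)]
      ring_nf
    · rw [if_neg (not_le.2 hk), if_pos hk, zero_add, abs_of_pos (by exact_mod_cast hk)]
      ring_nf
  simp_rw [hpt]
  rw [ENNReal.tsum_add, tsum_ite_le_two_rpow_half,
    tsum_ite_lt_eq_tsum_nat 0 (fun k => (2 : ℝ≥0∞) ^ (-(k : ℝ) / 2))]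
  have h2 : ∀ k : ℕ, (2 : ℝ≥0∞) ^ (-(((0 + 1 + (k : ℤ) : ℤ) : ℝ)) / 2) =
      (2 : ℝ≥0∞) ^ ((-(1 / 2 : ℝ)) - (k : ℝ) * (1 / 2)) := fun k => by
    push_cast
    ring_nf
  simp_rw [h2]
  rw [tsum_two_rpow_sub_natCast_mul]
  have hfin : (1 - (2 : ℝ≥0∞) ^ (-(1 / 2 : ℝ)))⁻¹ ≠ ⊤ :=
    inv_one_sub_two_rpow_neg_ne_top (by norm_num)
  exact ENNReal.add_ne_top.2 ⟨ENNReal.mul_ne_top (two_rpow_ne_top _) hfin,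
    ENNReal.mul_ne_top (two_rpow_ne_top _) hfin⟩

/-- **The two-regime weight of the bilinear block estimate sums to the Schur kernel**: for
`m, m' ∈ ℤ`, `L = max(m, m')`, `ℓ = min(m, m')`,
`∑_{n ≤ L} 2^{n/2} 2^{ℓ/2 - L} + ∑_{n > L} 2^{-n} 2^{(m+m')/2} = ((1 - 2^{-1/2})⁻¹ + 1) 2^{-|m-m'|/2}`. [folklore] -/
theorem tsum_regimeWeight_eq (m m' : ℤ) :
    ∑' n : ℤ, ((if n ≤ max m m' then (2 : ℝ≥0∞) ^ ((n : ℝ) / 2) else 0) *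
        (2 : ℝ≥0∞) ^ ((min (m : ℝ) m') / 2 - max (m : ℝ) m') +
      (if max m m' < n then (2 : ℝ≥0∞) ^ (-(n : ℝ)) else 0) *
        (2 : ℝ≥0∞) ^ (((m : ℝ) + m') / 2)) =
      ((1 - (2 : ℝ≥0∞) ^ (-(1 / 2 : ℝ)))⁻¹ + 1) * (2 : ℝ≥0∞) ^ (-(|(m : ℝ) - m'| / 2)) := by
  rw [ENNReal.tsum_add, ENNReal.tsum_mul_right, ENNReal.tsum_mul_right, tsum_ite_le_two_rpow_half,
    tsum_ite_lt_two_rpow_neg]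
  have hmax : (((max m m' : ℤ)) : ℝ) = max (m : ℝ) m' := Int.cast_max
  rw [hmax]
  have habs : |(m : ℝ) - m'| = max (m : ℝ) m' - min (m : ℝ) m' := by
    rw [← max_sub_min_eq_abs, max_comm, min_comm]
  rw [habs, mul_comm ((2 : ℝ≥0∞) ^ (max (m : ℝ) ↑m' / 2)), mul_assoc, two_rpow_mul_two_rpow,
    two_rpow_mul_two_rpow, add_mul, one_mul]
  have hmm : (m : ℝ) + m' = max (m : ℝ) m' + min (m : ℝ) m' := (max_add_min _ _).symm
  congr 2
  · congr 1
    ring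
  · rw [hmm]
    ring_nf

end Dyadic

/-! ## The bilinear block estimate on `ℝ³` -/

section Bilinear

variable {ι κ ν : Type*} [Fintype ι] [Fintype κ] [Fintype ν]

/-- `dim ℝ³ = 3` as a real number, in the exponent of Bernstein's inequality. [folklore] -/
theorem finrank_R3_real : ((Module.finrank ℝ (EuclideanSpace ℝ (Fin 3)) : ℕ) : ℝ) = 3 := by
  rw [finrank_euclideanSpace_fin]; norm_num

/-- A continuous bilinear map applied to an `L^∞` and an `L²` field gives an `L²` field, with
`‖B(φ, ψ)‖₂ ≤ ‖B‖ ‖φ‖_∞ ‖ψ‖₂`. [folklore] -/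
theorem memLp_two_clm_apply_of_top_two
    (B : EuclideanSpace ℝ ι →L[ℝ] EuclideanSpace ℝ κ →L[ℝ] EuclideanSpace ℝ ν)
    {φ : EuclideanSpace ℝ (Fin 3) → EuclideanSpace ℝ ι} {ψ : EuclideanSpace ℝ (Fin 3) → EuclideanSpace ℝ κ}
    (hφ : MemLp φ ∞ volume) (hψ : MemLp ψ 2 volume) :
    MemLp (fun x => B (φ x) (ψ x)) 2 volume ∧
      eLpNorm (fun x => B (φ x) (ψ x)) 2 volume ≤ ‖B‖ₑ * eLpNorm φ ∞ volume * eLpNorm ψ 2 volume := by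
  have hb : ∀ᵐ x ∂(volume : Measure (EuclideanSpace ℝ (Fin 3))), ‖B (φ x) (ψ x)‖₊ ≤ ‖B‖₊ * ‖φ x‖₊ * ‖ψ x‖₊ :=
    Eventually.of_forall fun x => B.le_opNorm₂ (φ x) (ψ x)
  have hmeas : AEStronglyMeasurable (fun x => B (φ x) (ψ x)) volume :=
    B.continuous₂.comp_aestronglyMeasurable (hφ.1.prodMk hψ.1)
  refine ⟨MemLp.of_bilin (fun a b => B a b) ‖B‖₊ hφ hψ hmeas hb, ?_⟩
  exact eLpNorm_le_eLpNorm_mul_eLpNorm_of_nnnorm hφ.1 hψ.1 (fun a b => B a b) ‖B‖₊ hb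

/-- The same with the `L^∞` factor on the right: `‖B(φ, ψ)‖₂ ≤ ‖B‖ ‖φ‖₂ ‖ψ‖_∞`. [folklore] -/
theorem memLp_two_clm_apply_of_two_top
    (B : EuclideanSpace ℝ ι →L[ℝ] EuclideanSpace ℝ κ →L[ℝ] EuclideanSpace ℝ ν)
    {φ : EuclideanSpace ℝ (Fin 3) → EuclideanSpace ℝ ι} {ψ : EuclideanSpace ℝ (Fin 3) → EuclideanSpace ℝ κ}
    (hφ : MemLp φ 2 volume) (hψ : MemLp ψ ∞ volume) :
    MemLp (fun x => B (φ x) (ψ x)) 2 volume ∧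
      eLpNorm (fun x => B (φ x) (ψ x)) 2 volume ≤ ‖B‖ₑ * eLpNorm φ 2 volume * eLpNorm ψ ∞ volume := by
  have hb : ∀ᵐ x ∂(volume : Measure (EuclideanSpace ℝ (Fin 3))), ‖B (φ x) (ψ x)‖₊ ≤ ‖B‖₊ * ‖φ x‖₊ * ‖ψ x‖₊ :=
    Eventually.of_forall fun x => B.le_opNorm₂ (φ x) (ψ x)
  have hmeas : AEStronglyMeasurable (fun x => B (φ x) (ψ x)) volume :=
    B.continuous₂.comp_aestronglyMeasurable (hφ.1.prodMk hψ.1)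
  refine ⟨MemLp.of_bilin (fun a b => B a b) ‖B‖₊ hφ hψ hmeas hb, ?_⟩
  exact eLpNorm_le_eLpNorm_mul_eLpNorm_of_nnnorm hφ.1 hψ.1 (fun a b => B a b) ‖B‖₊ hb

/-- A continuous bilinear map applied to two `L^∞` fields: `‖B(φ, ψ)‖_∞ ≤ ‖B‖ ‖φ‖_∞ ‖ψ‖_∞`. [folklore] -/
theorem memLp_top_clm_apply_of_top_top
    (B : EuclideanSpace ℝ ι →L[ℝ] EuclideanSpace ℝ κ →L[ℝ] EuclideanSpace ℝ ν)
    {φ : EuclideanSpace ℝ (Fin 3) → EuclideanSpace ℝ ι} {ψ : EuclideanSpace ℝ (Fin 3) → EuclideanSpace ℝ κ}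
    (hφ : MemLp φ ∞ volume) (hψ : MemLp ψ ∞ volume) :
    MemLp (fun x => B (φ x) (ψ x)) ∞ volume ∧
      eLpNorm (fun x => B (φ x) (ψ x)) ∞ volume ≤ ‖B‖ₑ * eLpNorm φ ∞ volume * eLpNorm ψ ∞ volume := by
  have hb : ∀ᵐ x ∂(volume : Measure (EuclideanSpace ℝ (Fin 3))), ‖B (φ x) (ψ x)‖₊ ≤ ‖B‖₊ * ‖φ x‖₊ * ‖ψ x‖₊ :=
    Eventually.of_forall fun x => B.le_opNorm₂ (φ x) (ψ x)
  have hmeas : AEStronglyMeasurable (fun x => B (φ x) (ψ x)) volume :=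
    B.continuous₂.comp_aestronglyMeasurable (hφ.1.prodMk hψ.1)
  refine ⟨MemLp.of_bilin (fun a b => B a b) ‖B‖₊ hφ hψ hmeas hb, ?_⟩
  exact eLpNorm_le_eLpNorm_mul_eLpNorm_of_nnnorm hφ.1 hψ.1 (fun a b => B a b) ‖B‖₊ hb

/-- A continuous bilinear map applied to two `L²` fields gives an `L¹` field:
`‖B(φ, ψ)‖₁ ≤ ‖B‖ ‖φ‖₂ ‖ψ‖₂`. [folklore] -/
theorem memLp_one_clm_apply_of_two_two
    (B : EuclideanSpace ℝ ι →L[ℝ] EuclideanSpace ℝ κ →L[ℝ] EuclideanSpace ℝ ν)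
    {φ : EuclideanSpace ℝ (Fin 3) → EuclideanSpace ℝ ι} {ψ : EuclideanSpace ℝ (Fin 3) → EuclideanSpace ℝ κ}
    (hφ : MemLp φ 2 volume) (hψ : MemLp ψ 2 volume) :
    MemLp (fun x => B (φ x) (ψ x)) 1 volume ∧
      eLpNorm (fun x => B (φ x) (ψ x)) 1 volume ≤ ‖B‖ₑ * eLpNorm φ 2 volume * eLpNorm ψ 2 volume := by
  have hb : ∀ᵐ x ∂(volume : Measure (EuclideanSpace ℝ (Fin 3))), ‖B (φ x) (ψ x)‖₊ ≤ ‖B‖₊ * ‖φ x‖₊ * ‖ψ x‖₊ :=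
    Eventually.of_forall fun x => B.le_opNorm₂ (φ x) (ψ x)
  have hmeas : AEStronglyMeasurable (fun x => B (φ x) (ψ x)) volume :=
    B.continuous₂.comp_aestronglyMeasurable (hφ.1.prodMk hψ.1)
  haveI : ENNReal.HolderTriple 2 2 1 := ⟨by norm_num [ENNReal.inv_two_add_inv_two]⟩
  refine ⟨MemLp.of_bilin (fun a b => B a b) ‖B‖₊ hφ hψ hmeas hb, ?_⟩
  exact eLpNorm_le_eLpNorm_mul_eLpNorm_of_nnnorm hφ.1 hψ.1 (fun a b => B a b) ‖B‖₊ hb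

end Bilinear

/-! ## The estimate for one triple of frequencies -/

section Triple

variable {ι κ ν : Type*} [Fintype ι] [Fintype κ] [Fintype ν]

/-- Products of four dyadic factors. [folklore] -/
theorem two_rpow_mul_four (x₁ x₂ x₃ x₄ : ℝ) (a b : ℝ≥0∞) :
    (2 : ℝ≥0∞) ^ x₁ * (2 : ℝ≥0∞) ^ x₂ * ((2 : ℝ≥0∞) ^ x₃ * a) * ((2 : ℝ≥0∞) ^ x₄ * b) =
      (2 : ℝ≥0∞) ^ (x₁ + x₂ + x₃ + x₄) * (a * b) := by
  calc (2 : ℝ≥0∞) ^ x₁ * (2 : ℝ≥0∞) ^ x₂ * ((2 : ℝ≥0∞) ^ x₃ * a) * ((2 : ℝ≥0∞) ^ x₄ * b)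
      = (2 : ℝ≥0∞) ^ x₁ * (2 : ℝ≥0∞) ^ x₂ * (2 : ℝ≥0∞) ^ x₃ * (2 : ℝ≥0∞) ^ x₄ * (a * b) := by ring
    _ = (2 : ℝ≥0∞) ^ (x₁ + x₂ + x₃ + x₄) * (a * b) := by
        rw [two_rpow_mul_two_rpow, two_rpow_mul_two_rpow, two_rpow_mul_two_rpow]

/-- Products of three dyadic factors. [folklore] -/
theorem two_rpow_mul_three (x₁ x₂ x₃ : ℝ) (a b : ℝ≥0∞) :
    (2 : ℝ≥0∞) ^ x₁ * ((2 : ℝ≥0∞) ^ x₂ * a) * ((2 : ℝ≥0∞) ^ x₃ * b) =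
      (2 : ℝ≥0∞) ^ (x₁ + x₂ + x₃) * (a * b) := by
  calc (2 : ℝ≥0∞) ^ x₁ * ((2 : ℝ≥0∞) ^ x₂ * a) * ((2 : ℝ≥0∞) ^ x₃ * b)
      = (2 : ℝ≥0∞) ^ x₁ * (2 : ℝ≥0∞) ^ x₂ * (2 : ℝ≥0∞) ^ x₃ * (a * b) := by ring
    _ = (2 : ℝ≥0∞) ^ (x₁ + x₂ + x₃) * (a * b) := by
        rw [two_rpow_mul_two_rpow, two_rpow_mul_two_rpow]

/-- **The bilinear block estimate for one triple of frequencies** (Tao 2011, proof of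
Prop. 9.1, the two Bernstein estimates of the display after (9.7), here without the paraproduct
trichotomy: every pair `(M, M') = (2^m, 2^{m'})` of frequencies is estimated against every
output frequency `N = 2^n`). For `f, g ∈ L²(ℝ³)` with blocks `f_m = Δ̇_m f`, `g_{m'} = Δ̇_{m'} g`
and a continuous bilinear `B`: if `N ≤ max(M, M')`, Bernstein `L² → L^∞` on the output block and
`L² → L^∞` on the block of *lower* frequency give
`N⁻¹‖Δ̇_N B(f_m, g_{m'})‖_∞ ≤ K‖B‖ N^{1/2} min(M,M')^{1/2} max(M,M')⁻¹ (M‖f_m‖₂)(M'‖g_{m'}‖₂)`; if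
`N > max(M, M')`, the uniform `L^∞` bound of the output block and Bernstein on both input blocks
give `N⁻¹‖Δ̇_N B(f_m, g_{m'})‖_∞ ≤ K‖B‖ N⁻¹ (MM')^{1/2} (M‖f_m‖₂)(M'‖g_{m'}‖₂)`. [cite: Tao2011, Prop. 9.1 (proof, §9 p. 28)] -/
theorem exists_bilinear_triple_bound :
    ∃ K : ℝ≥0, ∀ (B : EuclideanSpace ℝ ι →L[ℝ] EuclideanSpace ℝ κ →L[ℝ] EuclideanSpace ℝ ν)
      ⦃f : EuclideanSpace ℝ (Fin 3) → EuclideanSpace ℝ ι⦄ ⦃g : EuclideanSpace ℝ (Fin 3) → EuclideanSpace ℝ κ⦄,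
      MemLp f 2 volume → MemLp g 2 volume → ∀ n m m' : ℤ,
      (2 : ℝ≥0∞) ^ (-(n : ℝ)) *
          eLpNorm (blockFn n (fun x => B (blockFn m f x) (blockFn m' g x))) ∞ volume ≤
        K * ‖B‖ₑ *
          ((if n ≤ max m m' then (2 : ℝ≥0∞) ^ ((n : ℝ) / 2) else 0) *
              (2 : ℝ≥0∞) ^ ((min (m : ℝ) m') / 2 - max (m : ℝ) m') +
            (if max m m' < n then (2 : ℝ≥0∞) ^ (-(n : ℝ)) else 0) *
              (2 : ℝ≥0∞) ^ (((m : ℝ) + m') / 2)) *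
          (((2 : ℝ≥0∞) ^ (m : ℝ) * eLpNorm (blockFn m f) 2 volume) *
            ((2 : ℝ≥0∞) ^ (m' : ℝ) * eLpNorm (blockFn m' g) 2 volume)) := by
  obtain ⟨Cf, hCf⟩ := exists_eLpNorm_top_blockFn_le_two_rpow (E := EuclideanSpace ℝ (Fin 3)) (ι := ι)
  obtain ⟨Cg, hCg⟩ := exists_eLpNorm_top_blockFn_le_two_rpow (E := EuclideanSpace ℝ (Fin 3)) (ι := κ)
  obtain ⟨C₂, hC₂⟩ := exists_eLpNorm_top_blockFn_le_eLpNorm (E := EuclideanSpace ℝ (Fin 3)) (ι := ν) 2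
  obtain ⟨Ci, hCi⟩ := exists_eLpNorm_top_blockFn_le_eLpNorm (E := EuclideanSpace ℝ (Fin 3)) (ι := ν) ∞
  refine ⟨max (C₂ * max Cf Cg) (Ci * Cf * Cg), fun B f g hf hg n m m' => ?_⟩
  have h3 : ((Module.finrank ℝ (EuclideanSpace ℝ (Fin 3)) : ℕ) : ℝ) = 3 := finrank_R3_real
  -- the blocks and their norms
  set φ : EuclideanSpace ℝ (Fin 3) → EuclideanSpace ℝ ι := blockFn m f with hφ
  set ψ : EuclideanSpace ℝ (Fin 3) → EuclideanSpace ℝ κ := blockFn m' g with hψ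
  have hφ2 : MemLp φ 2 volume := memLp_blockFn m hf one_le_two
  have hψ2 : MemLp ψ 2 volume := memLp_blockFn m' hg one_le_two
  have hφi : MemLp φ ∞ volume := memLp_top_blockFn m hf
  have hψi : MemLp ψ ∞ volume := memLp_top_blockFn m' hg
  set a : ℝ≥0∞ := eLpNorm φ 2 volume with ha
  set b : ℝ≥0∞ := eLpNorm ψ 2 volume with hb
  -- Bernstein on the input blocks
  have hφb : eLpNorm φ ∞ volume ≤ Cf * (2 : ℝ≥0∞) ^ ((m : ℝ) * 3 / 2) * a := by
    have h := hCf m hf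
    rwa [h3] at h
  have hψb : eLpNorm ψ ∞ volume ≤ Cg * (2 : ℝ≥0∞) ^ ((m' : ℝ) * 3 / 2) * b := by
    have h := hCg m' hg
    rwa [h3] at h
  set F : EuclideanSpace ℝ (Fin 3) → EuclideanSpace ℝ ν := fun x => B (φ x) (ψ x) with hF
  by_cases hn : n ≤ max m m'
  · -- `N ≤ max(M, M')`: Bernstein `L² → L^∞` on the output block
    rw [if_pos hn, if_neg (not_lt.2 hn), zero_mul, add_zero]
    have hF2 := hC₂ n (memLp_two_clm_apply_of_top_two B hφi hψ2).1
    rw [h3, ENNReal.toReal_ofNat] at hF2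
    have hF2' := hC₂ n (memLp_two_clm_apply_of_two_top B hφ2 hψi).1
    rw [h3, ENNReal.toReal_ofNat] at hF2'
    -- the two assignments of `L^∞` and `L²` to the input blocks
    have hα : eLpNorm (blockFn n F) ∞ volume ≤
        (C₂ * Cf : ℝ≥0) * ‖B‖ₑ * (2 : ℝ≥0∞) ^ ((n : ℝ) * 3 * 2⁻¹) *
          ((2 : ℝ≥0∞) ^ ((m : ℝ) * 3 / 2) * a * b) :=
      calc eLpNorm (blockFn n F) ∞ volume
          ≤ C₂ * (2 : ℝ≥0∞) ^ ((n : ℝ) * 3 * 2⁻¹) * eLpNorm F 2 volume := hF2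
        _ ≤ C₂ * (2 : ℝ≥0∞) ^ ((n : ℝ) * 3 * 2⁻¹) * (‖B‖ₑ * eLpNorm φ ∞ volume * b) := by
            gcongr; exact (memLp_two_clm_apply_of_top_two B hφi hψ2).2
        _ ≤ C₂ * (2 : ℝ≥0∞) ^ ((n : ℝ) * 3 * 2⁻¹) *
              (‖B‖ₑ * (Cf * (2 : ℝ≥0∞) ^ ((m : ℝ) * 3 / 2) * a) * b) := by gcongr
        _ = (C₂ * Cf : ℝ≥0) * ‖B‖ₑ * (2 : ℝ≥0∞) ^ ((n : ℝ) * 3 * 2⁻¹) *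
              ((2 : ℝ≥0∞) ^ ((m : ℝ) * 3 / 2) * a * b) := by push_cast; ring
    have hβ : eLpNorm (blockFn n F) ∞ volume ≤
        (C₂ * Cg : ℝ≥0) * ‖B‖ₑ * (2 : ℝ≥0∞) ^ ((n : ℝ) * 3 * 2⁻¹) *
          ((2 : ℝ≥0∞) ^ ((m' : ℝ) * 3 / 2) * a * b) :=
      calc eLpNorm (blockFn n F) ∞ volume
          ≤ C₂ * (2 : ℝ≥0∞) ^ ((n : ℝ) * 3 * 2⁻¹) * eLpNorm F 2 volume := hF2'
        _ ≤ C₂ * (2 : ℝ≥0∞) ^ ((n : ℝ) * 3 * 2⁻¹) * (‖B‖ₑ * a * eLpNorm ψ ∞ volume) := by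
            gcongr; exact (memLp_two_clm_apply_of_two_top B hφ2 hψi).2
        _ ≤ C₂ * (2 : ℝ≥0∞) ^ ((n : ℝ) * 3 * 2⁻¹) *
              (‖B‖ₑ * a * (Cg * (2 : ℝ≥0∞) ^ ((m' : ℝ) * 3 / 2) * b)) := by gcongr
        _ = (C₂ * Cg : ℝ≥0) * ‖B‖ₑ * (2 : ℝ≥0∞) ^ ((n : ℝ) * 3 * 2⁻¹) *
              ((2 : ℝ≥0∞) ^ ((m' : ℝ) * 3 / 2) * a * b) := by push_cast; ring
    -- the constant
    have hK : ∀ {C : ℝ≥0}, C ≤ max Cf Cg → ((C₂ * C : ℝ≥0) : ℝ≥0∞) ≤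
        ((max (C₂ * max Cf Cg) (Ci * Cf * Cg) : ℝ≥0) : ℝ≥0∞) := fun hC =>
      ENNReal.coe_le_coe.2 ((mul_le_mul_of_nonneg_left hC zero_le).trans (le_max_left _ _))
    rcases le_total m m' with hmm | hmm
    · -- `m ≤ m'`: use `hα`
      have hmin : min (m : ℝ) m' = m := min_eq_left (by exact_mod_cast hmm)
      have hmax : max (m : ℝ) m' = m' := max_eq_right (by exact_mod_cast hmm)
      rw [hmin, hmax]
      calc (2 : ℝ≥0∞) ^ (-(n : ℝ)) * eLpNorm (blockFn n F) ∞ volume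
          ≤ (2 : ℝ≥0∞) ^ (-(n : ℝ)) * ((C₂ * Cf : ℝ≥0) * ‖B‖ₑ * (2 : ℝ≥0∞) ^ ((n : ℝ) * 3 * 2⁻¹) *
              ((2 : ℝ≥0∞) ^ ((m : ℝ) * 3 / 2) * a * b)) := by gcongr
        _ = (C₂ * Cf : ℝ≥0) * ‖B‖ₑ *
              ((2 : ℝ≥0∞) ^ (-(n : ℝ) + (n : ℝ) * 3 * 2⁻¹ + (m : ℝ) * 3 / 2) * (a * b)) := by
            rw [← two_rpow_mul_two_rpow, ← two_rpow_mul_two_rpow]; ring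
        _ = (C₂ * Cf : ℝ≥0) * ‖B‖ₑ *
              ((2 : ℝ≥0∞) ^ ((n : ℝ) / 2) * (2 : ℝ≥0∞) ^ ((m : ℝ) / 2 - m')) *
                (((2 : ℝ≥0∞) ^ (m : ℝ) * a) * ((2 : ℝ≥0∞) ^ (m' : ℝ) * b)) := by
            rw [show (-(n : ℝ) + (n : ℝ) * 3 * 2⁻¹ + (m : ℝ) * 3 / 2) =
                (n : ℝ) / 2 + ((m : ℝ) / 2 - m') + m + m' by ring,
              ← two_rpow_mul_two_rpow, ← two_rpow_mul_two_rpow, ← two_rpow_mul_two_rpow]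
            ring
        _ ≤ _ := by gcongr; exact_mod_cast hK (le_max_left _ _)
    · -- `m' ≤ m`: use `hβ`
      have hmin : min (m : ℝ) m' = m' := min_eq_right (by exact_mod_cast hmm)
      have hmax : max (m : ℝ) m' = m := max_eq_left (by exact_mod_cast hmm)
      rw [hmin, hmax]
      calc (2 : ℝ≥0∞) ^ (-(n : ℝ)) * eLpNorm (blockFn n F) ∞ volume
          ≤ (2 : ℝ≥0∞) ^ (-(n : ℝ)) * ((C₂ * Cg : ℝ≥0) * ‖B‖ₑ * (2 : ℝ≥0∞) ^ ((n : ℝ) * 3 * 2⁻¹) *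
              ((2 : ℝ≥0∞) ^ ((m' : ℝ) * 3 / 2) * a * b)) := by gcongr
        _ = (C₂ * Cg : ℝ≥0) * ‖B‖ₑ *
              ((2 : ℝ≥0∞) ^ (-(n : ℝ) + (n : ℝ) * 3 * 2⁻¹ + (m' : ℝ) * 3 / 2) * (a * b)) := by
            rw [← two_rpow_mul_two_rpow, ← two_rpow_mul_two_rpow]; ring
        _ = (C₂ * Cg : ℝ≥0) * ‖B‖ₑ *
              ((2 : ℝ≥0∞) ^ ((n : ℝ) / 2) * (2 : ℝ≥0∞) ^ ((m' : ℝ) / 2 - m)) *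
                (((2 : ℝ≥0∞) ^ (m : ℝ) * a) * ((2 : ℝ≥0∞) ^ (m' : ℝ) * b)) := by
            rw [show (-(n : ℝ) + (n : ℝ) * 3 * 2⁻¹ + (m' : ℝ) * 3 / 2) =
                (n : ℝ) / 2 + ((m' : ℝ) / 2 - m) + m + m' by ring,
              ← two_rpow_mul_two_rpow, ← two_rpow_mul_two_rpow, ← two_rpow_mul_two_rpow]
            ring
        _ ≤ _ := by gcongr; exact_mod_cast hK (le_max_right _ _)
  · -- `N > max(M, M')`: the uniform `L^∞` bound on the output block
    rw [if_neg hn, if_pos (not_le.1 hn), zero_mul, zero_add]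
    have hFi := hCi n (memLp_top_clm_apply_of_top_top B hφi hψi).1
    rw [ENNReal.toReal_top, inv_zero, mul_zero, ENNReal.rpow_zero, mul_one] at hFi
    have hγ : eLpNorm (blockFn n F) ∞ volume ≤
        (Ci * Cf * Cg : ℝ≥0) * ‖B‖ₑ *
          (((2 : ℝ≥0∞) ^ ((m : ℝ) * 3 / 2) * a) * ((2 : ℝ≥0∞) ^ ((m' : ℝ) * 3 / 2) * b)) :=
      calc eLpNorm (blockFn n F) ∞ volume ≤ Ci * eLpNorm F ∞ volume := hFi
        _ ≤ Ci * (‖B‖ₑ * eLpNorm φ ∞ volume * eLpNorm ψ ∞ volume) := by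
            gcongr; exact (memLp_top_clm_apply_of_top_top B hφi hψi).2
        _ ≤ Ci * (‖B‖ₑ * (Cf * (2 : ℝ≥0∞) ^ ((m : ℝ) * 3 / 2) * a) *
              (Cg * (2 : ℝ≥0∞) ^ ((m' : ℝ) * 3 / 2) * b)) := by gcongr
        _ = (Ci * Cf * Cg : ℝ≥0) * ‖B‖ₑ *
              (((2 : ℝ≥0∞) ^ ((m : ℝ) * 3 / 2) * a) * ((2 : ℝ≥0∞) ^ ((m' : ℝ) * 3 / 2) * b)) := by
            push_cast; ring
    have hK' : (Ci * Cf * Cg : ℝ≥0) ≤ max (C₂ * max Cf Cg) (Ci * Cf * Cg) := le_max_right _ _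
    calc (2 : ℝ≥0∞) ^ (-(n : ℝ)) * eLpNorm (blockFn n F) ∞ volume
        ≤ (2 : ℝ≥0∞) ^ (-(n : ℝ)) * ((Ci * Cf * Cg : ℝ≥0) * ‖B‖ₑ *
            (((2 : ℝ≥0∞) ^ ((m : ℝ) * 3 / 2) * a) * ((2 : ℝ≥0∞) ^ ((m' : ℝ) * 3 / 2) * b))) := by
          gcongr
      _ = (Ci * Cf * Cg : ℝ≥0) * ‖B‖ₑ *
            ((2 : ℝ≥0∞) ^ (-(n : ℝ) + (m : ℝ) * 3 / 2 + (m' : ℝ) * 3 / 2) * (a * b)) := by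
          rw [← two_rpow_mul_three]; ring
      _ = (Ci * Cf * Cg : ℝ≥0) * ‖B‖ₑ *
            ((2 : ℝ≥0∞) ^ (-(n : ℝ)) * (2 : ℝ≥0∞) ^ (((m : ℝ) + m') / 2)) *
              (((2 : ℝ≥0∞) ^ (m : ℝ) * a) * ((2 : ℝ≥0∞) ^ (m' : ℝ) * b)) := by
          rw [show (-(n : ℝ) + (m : ℝ) * 3 / 2 + (m' : ℝ) * 3 / 2) =
              -(n : ℝ) + ((m : ℝ) + m') / 2 + m + m' by ring,
            ← two_rpow_mul_two_rpow, ← two_rpow_mul_two_rpow, ← two_rpow_mul_two_rpow]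
          ring
      _ ≤ _ := by gcongr

end Triple

/-! ## Summation: over the output frequency, over the expansion, and the main estimate -/

section Main

variable {ι κ ν : Type*} [Fintype ι] [Fintype κ] [Fintype ν]

/-- **Summation over the output frequency**: for every pair of input frequencies,
`∑_N N⁻¹ ‖Δ̇_N B(f_m, g_{m'})‖_∞ ≤ K ‖B‖ 2^{-|m-m'|/2} (2^m‖f_m‖₂)(2^{m'}‖g_{m'}‖₂)` (the two
regimes of `exists_bilinear_triple_bound` summed geometrically, `tsum_regimeWeight_eq`). [cite: Tao2011, Prop. 9.1 (proof, §9 p. 28)] -/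
theorem exists_bilinear_pair_bound :
    ∃ K : ℝ≥0, ∀ (B : EuclideanSpace ℝ ι →L[ℝ] EuclideanSpace ℝ κ →L[ℝ] EuclideanSpace ℝ ν)
      ⦃f : EuclideanSpace ℝ (Fin 3) → EuclideanSpace ℝ ι⦄ ⦃g : EuclideanSpace ℝ (Fin 3) → EuclideanSpace ℝ κ⦄,
      MemLp f 2 volume → MemLp g 2 volume → ∀ m m' : ℤ,
      ∑' n : ℤ, (2 : ℝ≥0∞) ^ (-(n : ℝ)) *
          eLpNorm (blockFn n (fun x => B (blockFn m f x) (blockFn m' g x))) ∞ volume ≤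
        K * ‖B‖ₑ * (2 : ℝ≥0∞) ^ (-(|(m : ℝ) - m'| / 2)) *
          (((2 : ℝ≥0∞) ^ (m : ℝ) * eLpNorm (blockFn m f) 2 volume) *
            ((2 : ℝ≥0∞) ^ (m' : ℝ) * eLpNorm (blockFn m' g) 2 volume)) := by
  obtain ⟨K₁, hK₁⟩ := exists_bilinear_triple_bound (ι := ι) (κ := κ) (ν := ν)
  set S₁ : ℝ≥0∞ := (1 - (2 : ℝ≥0∞) ^ (-(1 / 2 : ℝ)))⁻¹ + 1 with hS₁
  have hS₁top : S₁ ≠ ⊤ :=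
    ENNReal.add_ne_top.2 ⟨inv_one_sub_two_rpow_neg_ne_top (by norm_num), ENNReal.one_ne_top⟩
  refine ⟨K₁ * S₁.toNNReal, fun B f g hf hg m m' => ?_⟩
  have hcoe : ((K₁ * S₁.toNNReal : ℝ≥0) : ℝ≥0∞) = K₁ * S₁ := by
    rw [ENNReal.coe_mul, ENNReal.coe_toNNReal hS₁top]
  set X : ℝ≥0∞ := ((2 : ℝ≥0∞) ^ (m : ℝ) * eLpNorm (blockFn m f) 2 volume) *
    ((2 : ℝ≥0∞) ^ (m' : ℝ) * eLpNorm (blockFn m' g) 2 volume) with hX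
  calc ∑' n : ℤ, (2 : ℝ≥0∞) ^ (-(n : ℝ)) *
          eLpNorm (blockFn n (fun x => B (blockFn m f x) (blockFn m' g x))) ∞ volume
      ≤ ∑' n : ℤ, (K₁ * ‖B‖ₑ * X) *
          ((if n ≤ max m m' then (2 : ℝ≥0∞) ^ ((n : ℝ) / 2) else 0) *
              (2 : ℝ≥0∞) ^ ((min (m : ℝ) m') / 2 - max (m : ℝ) m') +
            (if max m m' < n then (2 : ℝ≥0∞) ^ (-(n : ℝ)) else 0) *
              (2 : ℝ≥0∞) ^ (((m : ℝ) + m') / 2)) := by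
        refine ENNReal.tsum_le_tsum fun n => (hK₁ B hf hg n m m').trans (le_of_eq ?_)
        rw [hX]; ring
    _ = (K₁ * ‖B‖ₑ * X) * (S₁ * (2 : ℝ≥0∞) ^ (-(|(m : ℝ) - m'| / 2))) := by
        rw [ENNReal.tsum_mul_left, tsum_regimeWeight_eq]
    _ = ((K₁ * S₁.toNNReal : ℝ≥0) : ℝ≥0∞) * ‖B‖ₑ * (2 : ℝ≥0∞) ^ (-(|(m : ℝ) - m'| / 2)) * X := by
        rw [hcoe]; ring

omit [Fintype ι] [Fintype κ] in
/-- **Bilinear expansion of a product of finite sums.** [folklore] -/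
theorem clm_apply_sum_sum_eq
    (B : EuclideanSpace ℝ ι →L[ℝ] EuclideanSpace ℝ κ →L[ℝ] EuclideanSpace ℝ ν)
    (S T : Finset ℤ) (φ : ℤ → EuclideanSpace ℝ (Fin 3) → EuclideanSpace ℝ ι) (ψ : ℤ → EuclideanSpace ℝ (Fin 3) → EuclideanSpace ℝ κ) :
    (fun x => B ((∑ m ∈ S, φ m) x) ((∑ m' ∈ T, ψ m') x)) =
      ∑ m ∈ S, ∑ m' ∈ T, fun x => B (φ m x) (ψ m' x) := by
  funext x
  simp only [Finset.sum_apply, map_sum, FunLike.coe_sum, Finset.sum_apply]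
  exact Finset.sum_comm

/-- **Blocks of the expansion**: the `L^∞` norm of the block of a product of finite sums of `L²`
fields is at most the sum of the `L^∞` norms of the blocks of the individual products. [folklore] -/
theorem eLpNorm_top_blockFn_clm_sum_sum_le
    (B : EuclideanSpace ℝ ι →L[ℝ] EuclideanSpace ℝ κ →L[ℝ] EuclideanSpace ℝ ν)
    (S T : Finset ℤ) {φ : ℤ → EuclideanSpace ℝ (Fin 3) → EuclideanSpace ℝ ι} {ψ : ℤ → EuclideanSpace ℝ (Fin 3) → EuclideanSpace ℝ κ}
    (hφ : ∀ m, MemLp (φ m) 2 volume) (hψ : ∀ m', MemLp (ψ m') 2 volume) (n : ℤ) :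
    eLpNorm (blockFn n (fun x => B ((∑ m ∈ S, φ m) x) ((∑ m' ∈ T, ψ m') x))) ∞ volume ≤
      ∑ m ∈ S, ∑ m' ∈ T, eLpNorm (blockFn n (fun x => B (φ m x) (ψ m' x))) ∞ volume := by
  have hv1 : ∀ m m', MemLp (fun x => B (φ m x) (ψ m' x)) 1 volume := fun m m' =>
    (memLp_one_clm_apply_of_two_two B (hφ m) (hψ m')).1
  have hsum : blockFn n (∑ m ∈ S, ∑ m' ∈ T, fun x => B (φ m x) (ψ m' x)) =
      ∑ m ∈ S, ∑ m' ∈ T, blockFn n (fun x => B (φ m x) (ψ m' x)) := by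
    rw [blockFn_sum n S (v := fun m => ∑ m' ∈ T, fun x => B (φ m x) (ψ m' x)) (p := 1)
      (fun m _ => memLp_finsetSum' T fun m' _ => hv1 m m')]
    exact Finset.sum_congr rfl fun m _ =>
      blockFn_sum n T (v := fun m' => fun x => B (φ m x) (ψ m' x)) (p := 1) fun m' _ => hv1 m m'
  rw [clm_apply_sum_sum_eq, hsum]
  calc eLpNorm (∑ m ∈ S, ∑ m' ∈ T, blockFn n (fun x => B (φ m x) (ψ m' x))) ∞ volume
      ≤ ∑ m ∈ S, eLpNorm (∑ m' ∈ T, blockFn n (fun x => B (φ m x) (ψ m' x))) ∞ volume :=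
        eLpNorm_sum_le (fun m _ => Finset.aestronglyMeasurable_sum _ fun m' _ =>
          aestronglyMeasurable_blockFn n (hv1 m m').1) le_top
    _ ≤ ∑ m ∈ S, ∑ m' ∈ T, eLpNorm (blockFn n (fun x => B (φ m x) (ψ m' x))) ∞ volume :=
        Finset.sum_le_sum fun m _ => eLpNorm_sum_le
          (fun m' _ => aestronglyMeasurable_blockFn n (hv1 m m').1) le_top

/-- **`L¹` stability of the block of a product**: for `f, f', g, g' ∈ L²`,
`‖Δ̇_n B(f, g) − Δ̇_n B(f', g')‖_∞ ≤ C 2^{3n} ‖B‖ (‖f − f'‖₂ ‖g‖₂ + ‖f'‖₂ ‖g − g'‖₂)`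
(Bernstein `L¹ → L^∞` on the block and `B(f, g) − B(f', g') = B(f − f', g) + B(f', g − g')`). [cite: BahouriCheminDanchin2011, Lemma 2.1] -/
theorem exists_eLpNorm_top_blockFn_clm_sub_le :
    ∃ C : ℝ≥0, ∀ (B : EuclideanSpace ℝ ι →L[ℝ] EuclideanSpace ℝ κ →L[ℝ] EuclideanSpace ℝ ν)
      ⦃f f' : EuclideanSpace ℝ (Fin 3) → EuclideanSpace ℝ ι⦄ ⦃g g' : EuclideanSpace ℝ (Fin 3) → EuclideanSpace ℝ κ⦄,
      MemLp f 2 volume → MemLp f' 2 volume → MemLp g 2 volume → MemLp g' 2 volume → ∀ n : ℤ,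
      eLpNorm (blockFn n (fun x => B (f x) (g x)) - blockFn n (fun x => B (f' x) (g' x))) ∞ volume ≤
        C * (2 : ℝ≥0∞) ^ ((n : ℝ) * 3) *
          (‖B‖ₑ * eLpNorm (f - f') 2 volume * eLpNorm g 2 volume +
            ‖B‖ₑ * eLpNorm f' 2 volume * eLpNorm (g - g') 2 volume) := by
  obtain ⟨C₁, hC₁⟩ := exists_eLpNorm_top_blockFn_le_eLpNorm (E := EuclideanSpace ℝ (Fin 3)) (ι := ν) 1
  refine ⟨C₁, fun B f f' g g' hf hf' hg hg' n => ?_⟩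
  have h3 : ((Module.finrank ℝ (EuclideanSpace ℝ (Fin 3)) : ℕ) : ℝ) = 3 := finrank_R3_real
  have hF : MemLp (fun x => B (f x) (g x)) 1 volume := (memLp_one_clm_apply_of_two_two B hf hg).1
  have hF' : MemLp (fun x => B (f' x) (g' x)) 1 volume :=
    (memLp_one_clm_apply_of_two_two B hf' hg').1
  rw [← blockFn_sub n hF hF']
  have h := hC₁ n (hF.sub hF')
  rw [h3, ENNReal.toReal_one, inv_one, mul_one] at h
  refine h.trans ?_
  gcongr
  have hdec : ((fun x => B (f x) (g x)) - fun x => B (f' x) (g' x)) =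
      (fun x => B ((f - f') x) (g x)) + fun x => B (f' x) ((g - g') x) := by
    funext x
    simp only [Pi.sub_apply, Pi.add_apply, map_sub]
    rw [show (B (f x) - B (f' x)) (g x) = B (f x) (g x) - B (f' x) (g x) from rfl]
    abel
  rw [hdec]
  refine (eLpNorm_add_le ?_ ?_ le_rfl).trans (add_le_add ?_ ?_)
  · exact (memLp_one_clm_apply_of_two_two B (hf.sub hf') hg).1.1
  · exact (memLp_one_clm_apply_of_two_two B hf' (hg.sub hg')).1.1
  · exact (memLp_one_clm_apply_of_two_two B (hf.sub hf') hg).2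
  · exact (memLp_one_clm_apply_of_two_two B hf' (hg.sub hg')).2

/-- **The block of a product is dominated by the blocks of the products of the blocks**:
`‖Δ̇_n B(f, g)‖_∞ ≤ ∑_{m, m'} ‖Δ̇_n B(Δ̇_m f, Δ̇_{m'} g)‖_∞` for `f, g ∈ L²` — the Littlewood–Paley
decompositions of `f` and `g` converge in `L²` (`tendsto_eLpNorm_sub_sum_blockFn`), so the
products of the partial sums converge to `B(f, g)` in `L¹`, on which `Δ̇_n : L¹ → L^∞` is bounded
(Bernstein); the blocks of the partial products expand by bilinearity. [cite: BahouriCheminDanchin2011, Prop. 2.12 + Lemma 2.1] -/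
theorem eLpNorm_top_blockFn_bilinear_le_tsum
    (B : EuclideanSpace ℝ ι →L[ℝ] EuclideanSpace ℝ κ →L[ℝ] EuclideanSpace ℝ ν)
    {f : EuclideanSpace ℝ (Fin 3) → EuclideanSpace ℝ ι} {g : EuclideanSpace ℝ (Fin 3) → EuclideanSpace ℝ κ}
    (hf : MemLp f 2 volume) (hg : MemLp g 2 volume) (n : ℤ) :
    eLpNorm (blockFn n (fun x => B (f x) (g x))) ∞ volume ≤
      ∑' m : ℤ, ∑' m' : ℤ, eLpNorm (blockFn n (fun x => B (blockFn m f x) (blockFn m' g x))) ∞ volume := by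
  obtain ⟨C, hC⟩ := exists_eLpNorm_top_blockFn_clm_sub_le (ι := ι) (κ := κ) (ν := ν)
  have hbm : ∀ m, MemLp (blockFn m f) 2 volume := fun m => memLp_blockFn m hf one_le_two
  have hbm' : ∀ m', MemLp (blockFn m' g) 2 volume := fun m' => memLp_blockFn m' hg one_le_two
  have hfN : ∀ N : ℕ, MemLp (∑ m ∈ Finset.Icc (-(N : ℤ)) N, blockFn m f) 2 volume := fun N =>
    memLp_finsetSum' _ fun m _ => hbm m
  have hgN : ∀ N : ℕ, MemLp (∑ m ∈ Finset.Icc (-(N : ℤ)) N, blockFn m g) 2 volume := fun N =>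
    memLp_finsetSum' _ fun m _ => hbm' m
  have hfconv : Tendsto (fun N : ℕ => eLpNorm (f - ∑ m ∈ Finset.Icc (-(N : ℤ)) N, blockFn m f) 2 volume)
      atTop (𝓝 0) := tendsto_eLpNorm_sub_sum_blockFn hf
  have hgconv : Tendsto (fun N : ℕ => eLpNorm (g - ∑ m ∈ Finset.Icc (-(N : ℤ)) N, blockFn m g) 2 volume)
      atTop (𝓝 0) := tendsto_eLpNorm_sub_sum_blockFn hg
  -- the partial products are dominated by the double series
  have hpartial : ∀ N : ℕ,
      eLpNorm (blockFn n (fun x => B ((∑ m ∈ Finset.Icc (-(N : ℤ)) N, blockFn m f) x)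
        ((∑ m' ∈ Finset.Icc (-(N : ℤ)) N, blockFn m' g) x))) ∞ volume ≤
      ∑' m : ℤ, ∑' m' : ℤ, eLpNorm (blockFn n (fun x => B (blockFn m f x) (blockFn m' g x))) ∞ volume := by
    intro N
    refine (eLpNorm_top_blockFn_clm_sum_sum_le B _ _ hbm hbm' n).trans ?_
    calc ∑ m ∈ Finset.Icc (-(N : ℤ)) N, ∑ m' ∈ Finset.Icc (-(N : ℤ)) N,
          eLpNorm (blockFn n (fun x => B (blockFn m f x) (blockFn m' g x))) ∞ volume
        ≤ ∑ m ∈ Finset.Icc (-(N : ℤ)) N, ∑' m' : ℤ,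
          eLpNorm (blockFn n (fun x => B (blockFn m f x) (blockFn m' g x))) ∞ volume :=
          Finset.sum_le_sum fun m _ => ENNReal.sum_le_tsum _
      _ ≤ _ := ENNReal.sum_le_tsum _
  -- the error of the partial products tends to zero
  have hf2 : eLpNorm f 2 volume ≠ ⊤ := hf.eLpNorm_ne_top
  have hg2 : eLpNorm g 2 volume ≠ ⊤ := hg.eLpNorm_ne_top
  have hB : (‖B‖ₑ : ℝ≥0∞) ≠ ⊤ := enorm_ne_top
  have hfNle : ∀ N : ℕ, eLpNorm (∑ m ∈ Finset.Icc (-(N : ℤ)) N, blockFn m f) 2 volume ≤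
      eLpNorm f 2 volume + eLpNorm (f - ∑ m ∈ Finset.Icc (-(N : ℤ)) N, blockFn m f) 2 volume := by
    intro N
    calc eLpNorm (∑ m ∈ Finset.Icc (-(N : ℤ)) N, blockFn m f) 2 volume
        = eLpNorm (f - (f - ∑ m ∈ Finset.Icc (-(N : ℤ)) N, blockFn m f)) 2 volume := by
          rw [sub_sub_cancel]
      _ ≤ _ := eLpNorm_sub_le hf.1 (hf.sub (hfN N)).1 one_le_two
  have herrlim : Tendsto (fun N : ℕ => (C : ℝ≥0∞) * (2 : ℝ≥0∞) ^ ((n : ℝ) * 3) *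
      (‖B‖ₑ * eLpNorm (f - ∑ m ∈ Finset.Icc (-(N : ℤ)) N, blockFn m f) 2 volume * eLpNorm g 2 volume +
        ‖B‖ₑ * (eLpNorm f 2 volume + eLpNorm (f - ∑ m ∈ Finset.Icc (-(N : ℤ)) N, blockFn m f) 2 volume) *
          eLpNorm (g - ∑ m ∈ Finset.Icc (-(N : ℤ)) N, blockFn m g) 2 volume)) atTop (𝓝 0) := by
    have h1 : Tendsto (fun N : ℕ => ‖B‖ₑ *
        eLpNorm (f - ∑ m ∈ Finset.Icc (-(N : ℤ)) N, blockFn m f) 2 volume * eLpNorm g 2 volume)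
        atTop (𝓝 0) := by
      have h := ENNReal.Tendsto.mul_const (ENNReal.Tendsto.const_mul hfconv (Or.inr hB)) (Or.inr hg2)
      rwa [mul_zero, zero_mul] at h
    have h2 : Tendsto (fun N : ℕ => ‖B‖ₑ *
        (eLpNorm f 2 volume + eLpNorm (f - ∑ m ∈ Finset.Icc (-(N : ℤ)) N, blockFn m f) 2 volume) *
        eLpNorm (g - ∑ m ∈ Finset.Icc (-(N : ℤ)) N, blockFn m g) 2 volume) atTop (𝓝 0) := by
      have ha : Tendsto (fun N : ℕ => ‖B‖ₑ *
          (eLpNorm f 2 volume + eLpNorm (f - ∑ m ∈ Finset.Icc (-(N : ℤ)) N, blockFn m f) 2 volume))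
          atTop (𝓝 (‖B‖ₑ * (eLpNorm f 2 volume + 0))) :=
        ENNReal.Tendsto.const_mul (tendsto_const_nhds.add hfconv) (Or.inr hB)
      have hA₀ : ‖B‖ₑ * (eLpNorm f 2 volume + 0) ≠ ⊤ := by
        rw [add_zero]; exact ENNReal.mul_ne_top hB hf2
      have h := ENNReal.Tendsto.mul ha (Or.inr ENNReal.zero_ne_top) hgconv (Or.inr hA₀)
      rwa [mul_zero] at h
    have hc : (C : ℝ≥0∞) * (2 : ℝ≥0∞) ^ ((n : ℝ) * 3) ≠ ⊤ :=
      ENNReal.mul_ne_top ENNReal.coe_ne_top (two_rpow_ne_top _)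
    have h := ENNReal.Tendsto.const_mul (h1.add h2) (Or.inr hc)
    rwa [add_zero, mul_zero] at h
  -- conclusion
  set T : ℝ≥0∞ := ∑' m : ℤ, ∑' m' : ℤ,
    eLpNorm (blockFn n (fun x => B (blockFn m f x) (blockFn m' g x))) ∞ volume with hT
  have hbound : ∀ N : ℕ, eLpNorm (blockFn n (fun x => B (f x) (g x))) ∞ volume ≤
      T + (C : ℝ≥0∞) * (2 : ℝ≥0∞) ^ ((n : ℝ) * 3) *
      (‖B‖ₑ * eLpNorm (f - ∑ m ∈ Finset.Icc (-(N : ℤ)) N, blockFn m f) 2 volume * eLpNorm g 2 volume +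
        ‖B‖ₑ * (eLpNorm f 2 volume + eLpNorm (f - ∑ m ∈ Finset.Icc (-(N : ℤ)) N, blockFn m f) 2 volume) *
          eLpNorm (g - ∑ m ∈ Finset.Icc (-(N : ℤ)) N, blockFn m g) 2 volume) := by
    intro N
    have hF : MemLp (fun x => B (f x) (g x)) 1 volume := (memLp_one_clm_apply_of_two_two B hf hg).1
    have hFN : MemLp (fun x => B ((∑ m ∈ Finset.Icc (-(N : ℤ)) N, blockFn m f) x)
        ((∑ m' ∈ Finset.Icc (-(N : ℤ)) N, blockFn m' g) x)) 1 volume :=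
      (memLp_one_clm_apply_of_two_two B (hfN N) (hgN N)).1
    have hm1 := aestronglyMeasurable_blockFn n hFN.1
    have hm2 := (aestronglyMeasurable_blockFn n hF.1).sub hm1
    calc eLpNorm (blockFn n (fun x => B (f x) (g x))) ∞ volume
        = eLpNorm (blockFn n (fun x => B ((∑ m ∈ Finset.Icc (-(N : ℤ)) N, blockFn m f) x)
            ((∑ m' ∈ Finset.Icc (-(N : ℤ)) N, blockFn m' g) x)) +
            (blockFn n (fun x => B (f x) (g x)) -
              blockFn n (fun x => B ((∑ m ∈ Finset.Icc (-(N : ℤ)) N, blockFn m f) x)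
                ((∑ m' ∈ Finset.Icc (-(N : ℤ)) N, blockFn m' g) x)))) ∞ volume := by
          rw [add_sub_cancel]
      _ ≤ _ := eLpNorm_add_le hm1 hm2 le_top
      _ ≤ _ := add_le_add (hpartial N) ((hC B hf (hfN N) hg (hgN N) n).trans (by gcongr; exact hfNle N))
  have hlim := (tendsto_const_nhds (x := T)).add herrlim
  rw [add_zero] at hlim
  exact ge_of_tendsto' hlim hbound

/-- `(C X²)^{1/2} = C^{1/2} X` in `ℝ≥0∞`. [folklore] -/
theorem rpow_half_mul_sq (C X : ℝ≥0∞) : (C * X ^ 2) ^ (1 / 2 : ℝ) = C ^ (1 / 2 : ℝ) * X := by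
  rw [ENNReal.mul_rpow_of_nonneg _ _ (by norm_num), ← ENNReal.rpow_two, ← ENNReal.rpow_mul]
  norm_num

/-- **The bilinear Littlewood–Paley block estimate** (Tao 2011, proof of Prop. 9.1, the estimate
of (9.7): "`∑_N ∫₀ᵀ N⁻¹ ‖P_N O(uu)(t')‖_{L^∞_x} dt' ≲ … ≲ ∑_N a_N² ≲ E₀`", at a fixed time and
for a general continuous bilinear map `B`). For `C¹` fields `f, g ∈ L²(ℝ³)` with `Df, Dg ∈ L²`,

  `∑_{N ∈ 2^ℤ} N⁻¹ ‖P_N B(f, g)‖_{L^∞(ℝ³)} ≤ C ‖B‖ ‖Df‖_{L²} ‖Dg‖_{L²}`.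

Proof: `‖P_N B(f,g)‖_∞ ≤ ∑_{M,M'} ‖P_N B(f_M, g_{M'})‖_∞` (`eLpNorm_top_blockFn_bilinear_le_tsum`);
for each pair, `∑_N N⁻¹‖P_N B(f_M, g_{M'})‖_∞ ≲ ‖B‖ (min/max)^{1/2} (M‖f_M‖₂)(M'‖g_{M'}‖₂)` by the
three Bernstein bounds (`exists_bilinear_pair_bound`; this replaces the paraproduct trichotomy
of the printed proof, which needs no Fourier-support information on products); Schur's test for
the kernel `2^{-|m-m'|/2}` (`tsum_tsum_two_rpow_neg_abs_mul_le`) and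
`∑_M M²‖f_M‖₂² ≲ ‖Df‖₂²` (`exists_tsum_sq_blockFn_le_fderiv`, "Bessel"). [cite: Tao2011, Prop. 9.1 (proof, §9, (9.7) and p. 28)] -/
theorem exists_tsum_eLpNorm_top_blockFn_bilinear_le :
    ∃ C : ℝ≥0, ∀ (B : EuclideanSpace ℝ ι →L[ℝ] EuclideanSpace ℝ κ →L[ℝ] EuclideanSpace ℝ ν)
      ⦃f : EuclideanSpace ℝ (Fin 3) → EuclideanSpace ℝ ι⦄ ⦃g : EuclideanSpace ℝ (Fin 3) → EuclideanSpace ℝ κ⦄,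
      ContDiff ℝ 1 f → MemLp f 2 volume → MemLp (fderiv ℝ f) 2 volume →
      ContDiff ℝ 1 g → MemLp g 2 volume → MemLp (fderiv ℝ g) 2 volume →
      ∑' n : ℤ, (2 : ℝ≥0∞) ^ (-(n : ℝ)) * eLpNorm (blockFn n (fun x => B (f x) (g x))) ∞ volume ≤
        C * ‖B‖ₑ * eLpNorm (fderiv ℝ f) 2 volume * eLpNorm (fderiv ℝ g) 2 volume := by
  obtain ⟨K, hK⟩ := exists_bilinear_pair_bound (ι := ι) (κ := κ) (ν := ν)
  obtain ⟨Cf, hCf⟩ := exists_tsum_sq_blockFn_le_fderiv (E := EuclideanSpace ℝ (Fin 3)) (ι := ι)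
  obtain ⟨Cg, hCg⟩ := exists_tsum_sq_blockFn_le_fderiv (E := EuclideanSpace ℝ (Fin 3)) (ι := κ)
  set S : ℝ≥0∞ := ∑' k : ℤ, (2 : ℝ≥0∞) ^ (-(|(k : ℝ)| / 2)) with hS
  have hStop : S ≠ ⊤ := tsum_two_rpow_neg_abs_half_ne_top
  set C₀ : ℝ≥0∞ := K * S * ((Cf : ℝ≥0∞) ^ (1 / 2 : ℝ) * (Cg : ℝ≥0∞) ^ (1 / 2 : ℝ)) with hC₀
  have hC₀top : C₀ ≠ ⊤ :=
    ENNReal.mul_ne_top (ENNReal.mul_ne_top ENNReal.coe_ne_top hStop)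
      (ENNReal.mul_ne_top (ENNReal.rpow_ne_top_of_nonneg (by norm_num) ENNReal.coe_ne_top)
        (ENNReal.rpow_ne_top_of_nonneg (by norm_num) ENNReal.coe_ne_top))
  refine ⟨C₀.toNNReal, fun B f g hf1 hf2 hDf hg1 hg2 hDg => ?_⟩
  rw [ENNReal.coe_toNNReal hC₀top]
  -- the dyadic profiles
  set a : ℤ → ℝ≥0∞ := fun m => (2 : ℝ≥0∞) ^ (m : ℝ) * eLpNorm (blockFn m f) 2 volume with ha
  set b : ℤ → ℝ≥0∞ := fun m => (2 : ℝ≥0∞) ^ (m : ℝ) * eLpNorm (blockFn m g) 2 volume with hb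
  have ha2 : (∑' m, a m ^ 2) ^ (1 / 2 : ℝ) ≤ (Cf : ℝ≥0∞) ^ (1 / 2 : ℝ) * eLpNorm (fderiv ℝ f) 2 volume := by
    rw [← rpow_half_mul_sq]
    refine ENNReal.rpow_le_rpow ?_ (by norm_num)
    simpa only [ha, mul_pow] using hCf hf1 hf2 hDf
  have hb2 : (∑' m, b m ^ 2) ^ (1 / 2 : ℝ) ≤ (Cg : ℝ≥0∞) ^ (1 / 2 : ℝ) * eLpNorm (fderiv ℝ g) 2 volume := by
    rw [← rpow_half_mul_sq]
    refine ENNReal.rpow_le_rpow ?_ (by norm_num)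
    simpa only [hb, mul_pow] using hCg hg1 hg2 hDg
  calc ∑' n : ℤ, (2 : ℝ≥0∞) ^ (-(n : ℝ)) * eLpNorm (blockFn n (fun x => B (f x) (g x))) ∞ volume
      ≤ ∑' n : ℤ, (2 : ℝ≥0∞) ^ (-(n : ℝ)) * ∑' m : ℤ, ∑' m' : ℤ,
          eLpNorm (blockFn n (fun x => B (blockFn m f x) (blockFn m' g x))) ∞ volume := by
        gcongr with n
        exact eLpNorm_top_blockFn_bilinear_le_tsum B hf2 hg2 n
    _ = ∑' n : ℤ, ∑' m : ℤ, ∑' m' : ℤ, (2 : ℝ≥0∞) ^ (-(n : ℝ)) *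
          eLpNorm (blockFn n (fun x => B (blockFn m f x) (blockFn m' g x))) ∞ volume := by
        simp_rw [ENNReal.tsum_mul_left]
    _ = ∑' m : ℤ, ∑' m' : ℤ, ∑' n : ℤ, (2 : ℝ≥0∞) ^ (-(n : ℝ)) *
          eLpNorm (blockFn n (fun x => B (blockFn m f x) (blockFn m' g x))) ∞ volume := by
        rw [ENNReal.tsum_comm]
        exact tsum_congr fun m => ENNReal.tsum_comm
    _ ≤ ∑' m : ℤ, ∑' m' : ℤ, K * ‖B‖ₑ * (2 : ℝ≥0∞) ^ (-(|(m : ℝ) - m'| / 2)) * (a m * b m') :=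
        ENNReal.tsum_le_tsum fun m => ENNReal.tsum_le_tsum fun m' => hK B hf2 hg2 m m'
    _ = K * ‖B‖ₑ * ∑' m : ℤ, ∑' m' : ℤ, (2 : ℝ≥0∞) ^ (-(|(m : ℝ) - m'| / 2)) * (a m * b m') := by
        rw [← ENNReal.tsum_mul_left]
        refine tsum_congr fun m => ?_
        rw [← ENNReal.tsum_mul_left]
        exact tsum_congr fun m' => by ring
    _ ≤ K * ‖B‖ₑ * (S * ((∑' m, a m ^ 2) ^ (1 / 2 : ℝ) * (∑' m, b m ^ 2) ^ (1 / 2 : ℝ))) := by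
        gcongr
        exact tsum_tsum_two_rpow_neg_abs_mul_le a b
    _ ≤ K * ‖B‖ₑ * (S * (((Cf : ℝ≥0∞) ^ (1 / 2 : ℝ) * eLpNorm (fderiv ℝ f) 2 volume) *
          ((Cg : ℝ≥0∞) ^ (1 / 2 : ℝ) * eLpNorm (fderiv ℝ g) 2 volume))) := by gcongr
    _ = C₀ * ‖B‖ₑ * eLpNorm (fderiv ℝ f) 2 volume * eLpNorm (fderiv ℝ g) 2 volume := by
        rw [hC₀]; ring

end Main

end Literature.Analysis.FluidPDE

end
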